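import Summits.ResolutionOfSingularities.ResolutionOfSingularities.Theorems.EquisingularLiftEquisingularLiftNatBlowupSubstSquarefree
import Summits.ResolutionOfSingularities.ResolutionOfSingularities.Theorems.EquisingularLiftEquisingularLiftNatSquarefreeInitialForm
import Mathlib
import HarnessLib

/-!
# [OURS · L1 W4.5(b)] T-ΔLIFT-CENTRED-SQF (2/2) — the strict transforms of a REDUCED plane trace at a point of EXACT
# multiplicity `m` are square-free, hence Δ4-finite (crux `EquisingularLiftNatThree` = stmt-ResolutionOfSingularities-20148,
# parent `EquisingularLiftNat` = stmt-20038; rung v7 (TC⁺), ring input of T-ΔLIFT-CENTRED)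

NOT a statement of any manuscript. Helper file of the chain res-L1-w45b (cell `res-hironaka`, rung L, slot W4.5(b));
AI-written, weaker than expert review; filed `--supports stmt-ResolutionOfSingularities-20148 --as helper`; it closes nothing.

WHERE IT SITS. res-L1-w45b-stub-1's T-ΔLIFT-CENTRED (`exists_isHomogeneous_centred_lift_deltaRegular`, STATUS
2026-08-27T10:18:29Z; rung v7 (TC⁺) of res-L1-w45b-lead-2) lifts the reduced tangent-cone trace `g ∈ k[T₀,T₁,T₂]_d` CENTRED
at the section over its singular point `q = [1:0:0]`; the two charts of the blow-up of the `q`-chart carry the STRICT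
TRANSFORMS `gu, gv ∈ k[X₀, X₁]`: `g(1, X₀, X₀X₁) = X₀^m · gu`, `g(1, X₀X₁, X₁) = X₁^m · gv`, and the theorem takes as
HYPOTHESES (`hfinu`, `hfinv`) that their bad sets `{𝔮 | gu ∈ 𝔮, gu ∈ 𝔪_𝔮²}` are finite. This file DISCHARGES them from
what the (γ) engine holds downstairs: the trace is reduced on the `q`-chart (`Squarefree (dehomogenize 0 g)`, res-type-097
`…NatSquarefreeInitialForm` / T-TCONE (R2)) and `q` has EXACT multiplicity `m` (`∃ α ∈ g.support, α 1 + α 2 = m`, next to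
centredness `∀ α ∈ g.support, m ≤ α 1 + α 2`). Pure commutative algebra over a field `k`; no scheme appears.

CONTENT.
* `aeval_uChart_monomial` / `aeval_vChart_monomial`, `coeff_aeval_uChart_of_isHomogeneous` / `…vChart…` — the chart images
  of a form, monomial by monomial (`T^α ↦ X₀^{α₁+α₂} X₁^{α₂}`, resp. `X₀^{α₁} X₁^{α₁+α₂}`; injective on degree-`d` exponents);
* `not_X_dvd_strictTransform_fst/_snd` — a monomial of `(T₁,T₂)`-degree exactly `m` forces `X₀ ∤ gu`, `X₁ ∤ gv`;
* `aeval_uChart_eq_aeval_blowupSubst` / `…vChart…` — the chart images are the blow-up substitutions (part 1) of `g(1, X₀, X₁)`;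
* `squarefree_aeval_of_squarefree_dehomogenize_zero` — dictionary `k[T_j : j ≠ 0] ≅ k[X₀, X₁]` for square-freeness;
* **`squarefree_strictTransform_fst/_snd`** — `gu ≠ 0 ∧ X₀ ∤ gu ∧ Squarefree gu` (and for `gv`), by part 1's
  `squarefree_of_aeval_blowupSubst_eq`;
* **`finite_setOf_mem_sq_strictTransform_fst/_snd`** — HEADLINE = `hfinu` / `hfinv` of T-ΔLIFT-CENTRED (res-type-032's
  `finite_setOf_mem_sq`, p501885); `…_of_squarefree` — the same from a square-free FORM `g` (res-type-097
  `squarefree_dehomogenize_of_isHomogeneous`).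

References: folklore; H. Matsumura, *Commutative Ring Theory* (1986), Thm. 14.2 (context of the Δ-criterion, index only);
res-L1-w45b-stub-1 STATUS 2026-08-27T10:18:29Z (OURS planning text, index only).
-/

set_option linter.dupNamespace false -- mandated namespace `Summit.<Summit>.<Problem>` of this single-conjunct summit

noncomputable section

namespace Summit.ResolutionOfSingularities.ResolutionOfSingularities.Cruxes.EquisingularLiftNat.Sections

open MvPolynomial IsLocalRing Literature.AlgebraicGeometry.Resolution

universe u


/-! ## The two strict transforms of a ternary form at `q = [1:0:0]` -/

section Ternary

variable {k : Type u} [Field k]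

/-- The exponent of the image of `T^α` on the first blow-up chart: `T₀^{α₀} T₁^{α₁} T₂^{α₂} ↦ X₀^{α₁+α₂} X₁^{α₂}`. [folklore] -/
theorem aeval_uChart_monomial (α : Fin 3 →₀ ℕ) (c : k) :
    aeval ![(1 : MvPolynomial (Fin 2) k), X 0, X 0 * X 1] (monomial α c) =
      monomial (Finsupp.single 0 (α 1 + α 2) + Finsupp.single 1 (α 2)) c := by
  rw [aeval_monomial, algebraMap_eq, Finsupp.prod_fintype _ _ (fun _ => pow_zero _), Fin.prod_univ_three,
    monomial_eq, Finsupp.prod_fintype _ _ (fun _ => pow_zero _), Fin.prod_univ_two]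
  simp only [Matrix.cons_val_zero, Matrix.cons_val_one, Matrix.cons_val, one_pow, one_mul, Finsupp.coe_add,
    Pi.add_apply, Finsupp.single_eq_same, Finsupp.single_eq_of_ne (show (0 : Fin 2) ≠ 1 by decide),
    Finsupp.single_eq_of_ne (show (1 : Fin 2) ≠ 0 by decide), add_zero, zero_add]
  ring

/-- The exponent of the image of `T^α` on the second blow-up chart: `T₀^{α₀} T₁^{α₁} T₂^{α₂} ↦ X₀^{α₁} X₁^{α₁+α₂}`. [folklore] -/
theorem aeval_vChart_monomial (α : Fin 3 →₀ ℕ) (c : k) :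
    aeval ![(1 : MvPolynomial (Fin 2) k), X 0 * X 1, X 1] (monomial α c) =
      monomial (Finsupp.single 0 (α 1) + Finsupp.single 1 (α 1 + α 2)) c := by
  rw [aeval_monomial, algebraMap_eq, Finsupp.prod_fintype _ _ (fun _ => pow_zero _), Fin.prod_univ_three,
    monomial_eq, Finsupp.prod_fintype _ _ (fun _ => pow_zero _), Fin.prod_univ_two]
  simp only [Matrix.cons_val_zero, Matrix.cons_val_one, Matrix.cons_val, one_pow, one_mul, Finsupp.coe_add,
    Pi.add_apply, Finsupp.single_eq_same, Finsupp.single_eq_of_ne (show (0 : Fin 2) ≠ 1 by decide),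
    Finsupp.single_eq_of_ne (show (1 : Fin 2) ≠ 0 by decide), add_zero, zero_add]
  ring

omit [Field k] in
/-- The degree of an exponent vector in three variables. [folklore] -/
theorem degree_fin_three (α : Fin 3 →₀ ℕ) : α.degree = α 0 + α 1 + α 2 := by
  rw [Finsupp.degree_eq_sum, Fin.sum_univ_three]

omit [Field k] in
/-- On exponents of a fixed degree, `α ↦ (α₁ + α₂, α₂)` is injective. [folklore] -/
theorem uChart_exponent_injOn (d : ℕ) :
    Set.InjOn (fun α : Fin 3 →₀ ℕ => Finsupp.single (0 : Fin 2) (α 1 + α 2) + Finsupp.single 1 (α 2))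
      {α | α.degree = d} := by
  intro α hα β hβ h
  simp only [Set.mem_setOf_eq, degree_fin_three] at hα hβ
  have h1 := DFunLike.congr_fun h (1 : Fin 2)
  have h0 := DFunLike.congr_fun h (0 : Fin 2)
  simp only [Finsupp.coe_add, Pi.add_apply, Finsupp.single_eq_same,
    Finsupp.single_eq_of_ne (show (0 : Fin 2) ≠ 1 by decide),
    Finsupp.single_eq_of_ne (show (1 : Fin 2) ≠ 0 by decide), add_zero, zero_add] at h0 h1
  ext j
  fin_cases j <;> simp only [Fin.zero_eta, Fin.mk_one, Fin.reduceFinMk] <;> omega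

omit [Field k] in
/-- On exponents of a fixed degree, `α ↦ (α₁, α₁ + α₂)` is injective. [folklore] -/
theorem vChart_exponent_injOn (d : ℕ) :
    Set.InjOn (fun α : Fin 3 →₀ ℕ => Finsupp.single (0 : Fin 2) (α 1) + Finsupp.single 1 (α 1 + α 2))
      {α | α.degree = d} := by
  intro α hα β hβ h
  simp only [Set.mem_setOf_eq, degree_fin_three] at hα hβ
  have h1 := DFunLike.congr_fun h (1 : Fin 2)
  have h0 := DFunLike.congr_fun h (0 : Fin 2)
  simp only [Finsupp.coe_add, Pi.add_apply, Finsupp.single_eq_same,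
    Finsupp.single_eq_of_ne (show (0 : Fin 2) ≠ 1 by decide),
    Finsupp.single_eq_of_ne (show (1 : Fin 2) ≠ 0 by decide), add_zero, zero_add] at h0 h1
  ext j
  fin_cases j <;> simp only [Fin.zero_eta, Fin.mk_one, Fin.reduceFinMk] <;> omega

/-- **Coefficients on the first chart.** For a form `g` of degree `d` and `α ∈ supp g`, the coefficient of
`X₀^{α₁+α₂} X₁^{α₂}` in `g(1, X₀, X₀X₁)` is `coeff α g`. [folklore] [OURS · L1 W4.5b] -/
theorem coeff_aeval_uChart_of_isHomogeneous {g : MvPolynomial (Fin 3) k} {d : ℕ} (hg : g.IsHomogeneous d)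
    {α : Fin 3 →₀ ℕ} (hα : α ∈ g.support) :
    coeff (Finsupp.single 0 (α 1 + α 2) + Finsupp.single 1 (α 2)) (aeval ![(1 : MvPolynomial (Fin 2) k), X 0, X 0 * X 1] g) =
      coeff α g := by
  classical
  have hdeg : ∀ β ∈ g.support, β.degree = d := fun β hβ => by
    by_contra hne
    exact (mem_support_iff.mp hβ) (hg.coeff_eq_zero hne)
  conv_lhs => rw [g.as_sum, map_sum]
  simp_rw [aeval_uChart_monomial, coeff_sum, coeff_monomial]
  rw [Finset.sum_eq_single α]
  · rw [if_pos rfl]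
  · intro β hβ hne
    rw [if_neg]
    intro h
    exact hne (uChart_exponent_injOn d (hdeg β hβ) (hdeg α hα) h)
  · intro h
    exact absurd hα h

/-- **Coefficients on the second chart.** [folklore] [OURS · L1 W4.5b] -/
theorem coeff_aeval_vChart_of_isHomogeneous {g : MvPolynomial (Fin 3) k} {d : ℕ} (hg : g.IsHomogeneous d)
    {α : Fin 3 →₀ ℕ} (hα : α ∈ g.support) :
    coeff (Finsupp.single 0 (α 1) + Finsupp.single 1 (α 1 + α 2)) (aeval ![(1 : MvPolynomial (Fin 2) k), X 0 * X 1, X 1] g) =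
      coeff α g := by
  classical
  have hdeg : ∀ β ∈ g.support, β.degree = d := fun β hβ => by
    by_contra hne
    exact (mem_support_iff.mp hβ) (hg.coeff_eq_zero hne)
  conv_lhs => rw [g.as_sum, map_sum]
  simp_rw [aeval_vChart_monomial, coeff_sum, coeff_monomial]
  rw [Finset.sum_eq_single α]
  · rw [if_pos rfl]
  · intro β hβ hne
    rw [if_neg]
    intro h
    exact hne (vChart_exponent_injOn d (hdeg β hβ) (hdeg α hα) h)
  · intro h
    exact absurd hα h

/-- **Exact multiplicity `m` at `q = [1:0:0]` forces `X₀ ∤ gu`** (`g(1, X₀, X₀X₁) = X₀^m · gu`): the monomial of `g` of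
`(T₁,T₂)`-degree `m` survives in `gu` with `X₀`-exponent `0`. [folklore] [OURS · L1 W4.5b] -/
theorem not_X_dvd_strictTransform_fst {g : MvPolynomial (Fin 3) k} {d m : ℕ} (hg : g.IsHomogeneous d)
    (hexact : ∃ α ∈ g.support, α 1 + α 2 = m) {gu : MvPolynomial (Fin 2) k}
    (hgu : aeval ![(1 : MvPolynomial (Fin 2) k), X 0, X 0 * X 1] g = X 0 ^ m * gu) : ¬ X 0 ∣ gu := by
  classical
  obtain ⟨α, hα, hm⟩ := hexact
  rintro ⟨w, rfl⟩
  have h1 : coeff (Finsupp.single 0 (α 1 + α 2) + Finsupp.single 1 (α 2))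
      (aeval ![(1 : MvPolynomial (Fin 2) k), X 0, X 0 * X 1] g) = coeff α g :=
    coeff_aeval_uChart_of_isHomogeneous hg hα
  rw [hgu, hm, X_pow_eq_monomial, coeff_monomial_mul, one_mul, coeff_X_mul', if_neg] at h1
  · exact (mem_support_iff.mp hα) h1.symm
  · simp

/-- **Exact multiplicity `m` at `q = [1:0:0]` forces `X₁ ∤ gv`** (`g(1, X₀X₁, X₁) = X₁^m · gv`). [folklore] [OURS · L1 W4.5b] -/
theorem not_X_dvd_strictTransform_snd {g : MvPolynomial (Fin 3) k} {d m : ℕ} (hg : g.IsHomogeneous d)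
    (hexact : ∃ α ∈ g.support, α 1 + α 2 = m) {gv : MvPolynomial (Fin 2) k}
    (hgv : aeval ![(1 : MvPolynomial (Fin 2) k), X 0 * X 1, X 1] g = X 1 ^ m * gv) : ¬ X 1 ∣ gv := by
  classical
  obtain ⟨α, hα, hm⟩ := hexact
  rintro ⟨w, rfl⟩
  have h1 : coeff (Finsupp.single 0 (α 1) + Finsupp.single 1 (α 1 + α 2))
      (aeval ![(1 : MvPolynomial (Fin 2) k), X 0 * X 1, X 1] g) = coeff α g :=
    coeff_aeval_vChart_of_isHomogeneous hg hα
  rw [hgv, hm, add_comm (Finsupp.single 0 (α 1)), X_pow_eq_monomial, coeff_monomial_mul, one_mul, coeff_X_mul',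
    if_neg] at h1
  · exact (mem_support_iff.mp hα) h1.symm
  · simp

/-- The first strict transform is the blow-up substitution `β₀` applied to the dehomogenisation `g(1, X₀, X₁)`. [folklore] -/
theorem aeval_uChart_eq_aeval_blowupSubst (g : MvPolynomial (Fin 3) k) :
    aeval ![(1 : MvPolynomial (Fin 2) k), X 0, X 0 * X 1] g =
      aeval (fun j => if j = (0 : Fin 2) then (X 0 : MvPolynomial (Fin 2) k) else X 0 * X j)
        (aeval ![(1 : MvPolynomial (Fin 2) k), X 0, X 1] g) := by
  rw [comp_aeval_apply]
  have h : (fun j : Fin 3 => aeval (fun j => if j = (0 : Fin 2) then (X 0 : MvPolynomial (Fin 2) k) else X 0 * X j)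
      (![(1 : MvPolynomial (Fin 2) k), X 0, X 1] j)) = ![(1 : MvPolynomial (Fin 2) k), X 0, X 0 * X 1] := by
    funext j
    fin_cases j
    · simp
    · simp
    · simp
  rw [h]

/-- The second strict transform is the blow-up substitution `β₁` applied to `g(1, X₀, X₁)`. [folklore] -/
theorem aeval_vChart_eq_aeval_blowupSubst (g : MvPolynomial (Fin 3) k) :
    aeval ![(1 : MvPolynomial (Fin 2) k), X 0 * X 1, X 1] g =
      aeval (fun j => if j = (1 : Fin 2) then (X 1 : MvPolynomial (Fin 2) k) else X 1 * X j)
        (aeval ![(1 : MvPolynomial (Fin 2) k), X 0, X 1] g) := by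
  rw [comp_aeval_apply]
  have h : (fun j : Fin 3 => aeval (fun j => if j = (1 : Fin 2) then (X 1 : MvPolynomial (Fin 2) k) else X 1 * X j)
      (![(1 : MvPolynomial (Fin 2) k), X 0, X 1] j)) = ![(1 : MvPolynomial (Fin 2) k), X 0 * X 1, X 1] := by
    funext j
    fin_cases j
    · simp
    · simp [mul_comm]
    · simp
  rw [h]

/-- **Dictionary `k[T_j : j ≠ 0] ≅ k[X₀, X₁]`**: square-freeness of `dehomogenize 0 g` (the chart-ring currency of T-ΔLIFT /
T-TCONE) is square-freeness of `g(1, X₀, X₁)`. [folklore] [OURS · L1 W4.5b] -/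
theorem squarefree_aeval_of_squarefree_dehomogenize_zero {g : MvPolynomial (Fin 3) k}
    (hsq : Squarefree (dehomogenize (0 : Fin 3) g)) :
    Squarefree (aeval ![(1 : MvPolynomial (Fin 2) k), X 0, X 1] g) := by
  classical
  let e : {j : Fin 3 // j ≠ 0} ≃ Fin 2 :=
    { toFun := fun j => j.1.pred j.2
      invFun := fun l => ⟨l.succ, Fin.succ_ne_zero l⟩
      left_inv := fun j => Subtype.ext (Fin.succ_pred j.1 j.2)
      right_inv := fun l => Fin.pred_succ l }
  let E : MvPolynomial {j : Fin 3 // j ≠ 0} k ≃ₐ[k] MvPolynomial (Fin 2) k := renameEquiv k e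
  have hE : E (dehomogenize (0 : Fin 3) g) = aeval ![(1 : MvPolynomial (Fin 2) k), X 0, X 1] g := by
    change rename e (aeval (killVar 0) g) = _
    rw [← AlgHom.comp_apply, comp_aeval]
    have h : (fun j : Fin 3 => rename e (killVar (R := k) 0 j)) = ![(1 : MvPolynomial (Fin 2) k), X 0, X 1] := by
      funext j
      by_cases hj : j = 0
      · subst hj
        simp [killVar]
      · obtain ⟨l, rfl⟩ := Fin.exists_succ_eq.mpr hj
        rw [killVar_of_ne 0 hj, rename_X, Matrix.cons_val_succ]
        change X (Fin.pred (Fin.succ l) hj) = _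
        rw [Fin.pred_succ]
        fin_cases l <;> rfl
    rw [h]
  rw [← hE]
  exact squarefree_map_of_mulEquiv E.toMulEquiv hsq

/-- **The first strict transform of a reduced trace at a point of exact multiplicity is square-free.** In the binders of
T-ΔLIFT-CENTRED: `g ∈ k[T₀,T₁,T₂]_d` with square-free `dehomogenize 0 g`, a monomial of `(T₁,T₂)`-degree exactly `m`, and
`g(1, X₀, X₀X₁) = X₀^m · gu` ⟹ `gu ≠ 0`, `X₀ ∤ gu`, `Squarefree gu`. [folklore] [OURS · L1 W4.5b] -/
theorem squarefree_strictTransform_fst {g : MvPolynomial (Fin 3) k} {d m : ℕ} (hg : g.IsHomogeneous d)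
    (hexact : ∃ α ∈ g.support, α 1 + α 2 = m) (hsq : Squarefree (dehomogenize (0 : Fin 3) g))
    {gu : MvPolynomial (Fin 2) k} (hgu : aeval ![(1 : MvPolynomial (Fin 2) k), X 0, X 0 * X 1] g = X 0 ^ m * gu) :
    gu ≠ 0 ∧ ¬ X 0 ∣ gu ∧ Squarefree gu := by
  classical
  have hX : ¬ X 0 ∣ gu := not_X_dvd_strictTransform_fst hg hexact hgu
  refine ⟨fun h => hX (h ▸ dvd_zero _), hX, ?_⟩
  refine squarefree_of_aeval_blowupSubst_eq (m := m) (0 : Fin 2)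
    (squarefree_aeval_of_squarefree_dehomogenize_zero hsq) ?_ hX
  rw [← aeval_uChart_eq_aeval_blowupSubst, hgu]

/-- **The second strict transform of a reduced trace at a point of exact multiplicity is square-free**
(`g(1, X₀X₁, X₁) = X₁^m · gv` ⟹ `gv ≠ 0`, `X₁ ∤ gv`, `Squarefree gv`). [folklore] [OURS · L1 W4.5b] -/
theorem squarefree_strictTransform_snd {g : MvPolynomial (Fin 3) k} {d m : ℕ} (hg : g.IsHomogeneous d)
    (hexact : ∃ α ∈ g.support, α 1 + α 2 = m) (hsq : Squarefree (dehomogenize (0 : Fin 3) g))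
    {gv : MvPolynomial (Fin 2) k} (hgv : aeval ![(1 : MvPolynomial (Fin 2) k), X 0 * X 1, X 1] g = X 1 ^ m * gv) :
    gv ≠ 0 ∧ ¬ X 1 ∣ gv ∧ Squarefree gv := by
  classical
  have hX : ¬ X 1 ∣ gv := not_X_dvd_strictTransform_snd hg hexact hgv
  refine ⟨fun h => hX (h ▸ dvd_zero _), hX, ?_⟩
  refine squarefree_of_aeval_blowupSubst_eq (m := m) (1 : Fin 2)
    (squarefree_aeval_of_squarefree_dehomogenize_zero hsq) ?_ hX
  rw [← aeval_vChart_eq_aeval_blowupSubst, hgv]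

end Ternary

/-! ## HEADLINE: the bad sets of the strict transforms are finite (hypotheses `hfinu` / `hfinv` of T-ΔLIFT-CENTRED) -/

section Finite

variable {k : Type} [Field k]

/-- **T-ΔLIFT-CENTRED-SQF, first chart.** For a form `g ∈ k[T₀,T₁,T₂]_d` whose trace is reduced on the chart of
`q = [1:0:0]` (`Squarefree (dehomogenize 0 g)`) and which has a monomial of `(T₁,T₂)`-degree exactly `m` (exact multiplicity
`m` at `q`, given centredness), the strict transform `gu` (`g(1, X₀, X₀X₁) = X₀^m · gu`) has only finitely many primes
`𝔮 ∋ gu` with `gu ∈ 𝔪_𝔮²` — hypothesis `hfinu` of res-L1-w45b-stub-1's `exists_isHomogeneous_centred_lift_deltaRegular`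
(res-type-032 `finite_setOf_mem_sq`, p501885). [cite: Matsumura1987, Thm. 14.2] [OURS · L1 W4.5b] -/
theorem finite_setOf_mem_sq_strictTransform_fst {g : MvPolynomial (Fin 3) k} {d m : ℕ} (hg : g.IsHomogeneous d)
    (hexact : ∃ α ∈ g.support, α 1 + α 2 = m) (hsq : Squarefree (dehomogenize (0 : Fin 3) g))
    {gu : MvPolynomial (Fin 2) k} (hgu : aeval ![(1 : MvPolynomial (Fin 2) k), X 0, X 0 * X 1] g = X 0 ^ m * gu) :
    {𝔮 : PrimeSpectrum (MvPolynomial (Fin 2) k) | gu ∈ 𝔮.asIdeal ∧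
      algebraMap (MvPolynomial (Fin 2) k) (Localization.AtPrime 𝔮.asIdeal) gu ∈
        maximalIdeal (Localization.AtPrime 𝔮.asIdeal) ^ 2}.Finite :=
  have h := squarefree_strictTransform_fst hg hexact hsq hgu
  finite_setOf_mem_sq h.1 h.2.2

/-- **T-ΔLIFT-CENTRED-SQF, second chart** (`g(1, X₀X₁, X₁) = X₁^m · gv`; hypothesis `hfinv`). [cite: Matsumura1987, Thm. 14.2]
[OURS · L1 W4.5b] -/
theorem finite_setOf_mem_sq_strictTransform_snd {g : MvPolynomial (Fin 3) k} {d m : ℕ} (hg : g.IsHomogeneous d)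
    (hexact : ∃ α ∈ g.support, α 1 + α 2 = m) (hsq : Squarefree (dehomogenize (0 : Fin 3) g))
    {gv : MvPolynomial (Fin 2) k} (hgv : aeval ![(1 : MvPolynomial (Fin 2) k), X 0 * X 1, X 1] g = X 1 ^ m * gv) :
    {𝔮 : PrimeSpectrum (MvPolynomial (Fin 2) k) | gv ∈ 𝔮.asIdeal ∧
      algebraMap (MvPolynomial (Fin 2) k) (Localization.AtPrime 𝔮.asIdeal) gv ∈
        maximalIdeal (Localization.AtPrime 𝔮.asIdeal) ^ 2}.Finite :=
  have h := squarefree_strictTransform_snd hg hexact hsq hgv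
  finite_setOf_mem_sq h.1 h.2.2

/-- **T-ΔLIFT-CENTRED-SQF, first chart, from a square-free FORM** (`Squarefree g`, the «square-free part of the initial
form» of res-type-097's `exists_squarefree_initialForm`; its dehomogenisations are square-free by
`squarefree_dehomogenize_of_isHomogeneous`). [cite: Matsumura1987, Thm. 14.2] [OURS · L1 W4.5b] -/
theorem finite_setOf_mem_sq_strictTransform_fst_of_squarefree {g : MvPolynomial (Fin 3) k} {d m : ℕ}
    (hg : g.IsHomogeneous d) (hexact : ∃ α ∈ g.support, α 1 + α 2 = m) (hsq : Squarefree g)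
    {gu : MvPolynomial (Fin 2) k} (hgu : aeval ![(1 : MvPolynomial (Fin 2) k), X 0, X 0 * X 1] g = X 0 ^ m * gu) :
    {𝔮 : PrimeSpectrum (MvPolynomial (Fin 2) k) | gu ∈ 𝔮.asIdeal ∧
      algebraMap (MvPolynomial (Fin 2) k) (Localization.AtPrime 𝔮.asIdeal) gu ∈
        maximalIdeal (Localization.AtPrime 𝔮.asIdeal) ^ 2}.Finite := by
  classical
  exact finite_setOf_mem_sq_strictTransform_fst hg hexact (squarefree_dehomogenize_of_isHomogeneous 0 hg hsq) hgu

/-- **T-ΔLIFT-CENTRED-SQF, second chart, from a square-free FORM.** [cite: Matsumura1987, Thm. 14.2] [OURS · L1 W4.5b] -/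
theorem finite_setOf_mem_sq_strictTransform_snd_of_squarefree {g : MvPolynomial (Fin 3) k} {d m : ℕ}
    (hg : g.IsHomogeneous d) (hexact : ∃ α ∈ g.support, α 1 + α 2 = m) (hsq : Squarefree g)
    {gv : MvPolynomial (Fin 2) k} (hgv : aeval ![(1 : MvPolynomial (Fin 2) k), X 0 * X 1, X 1] g = X 1 ^ m * gv) :
    {𝔮 : PrimeSpectrum (MvPolynomial (Fin 2) k) | gv ∈ 𝔮.asIdeal ∧
      algebraMap (MvPolynomial (Fin 2) k) (Localization.AtPrime 𝔮.asIdeal) gv ∈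
        maximalIdeal (Localization.AtPrime 𝔮.asIdeal) ^ 2}.Finite := by
  classical
  exact finite_setOf_mem_sq_strictTransform_snd hg hexact (squarefree_dehomogenize_of_isHomogeneous 0 hg hsq) hgv

end Finite

end Summit.ResolutionOfSingularities.ResolutionOfSingularities.Cruxes.EquisingularLiftNat.Sections

end
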